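import Summits.HodgeConjecture.HodgeConjecture.Theorems.CyclicUnitaryPowersK1OfFermatGenus
import Literature.AlgebraicGeometry.HodgeTheory.SmoothHypersurfaceGeometricGenusLowerBound

/-!
# K1 `VeryGeneralDeckCommutatorsInHg` of route `CyclicUnitaryPowers` from {F1‡, CDK} and the ONE INEQUALITY `h^{2,0}(X²_p) ≤ C(p−1, 3)`
# (stmt-HodgeConjecture-19544; the minimal residual form of the binder PG)

Prover seat `hodge-nonav-prover-Bx` (g10), cell `hodge-nonav`. Landed `--supports stmt-HodgeConjecture-19544 --as helper`; sorry-free, no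
definition, no new named fact. CONDITIONAL results; nothing here says HC ∕ HC_AV is proved; rung F-H1 is not moved.

`CyclicUnitaryPowersK1OfFermatGenus` reduced PG's consumed clause to the EQUALITY `h^{2,0}(X²_p) = C(p−1,3)` for the Fermat surface of each
prime degree `p ≥ 5`. The inequality `≥` is already a tree theorem (Griffiths' residues at pole order one inject `S^{p−4} ↪ H^{2,0}`,
`choose_le_geometricGenus`), so the honest residual input is the single INEQUALITY

  `hFermatLe : ∀ p, p.Prime → 5 ≤ p → ∀ hHD hX, (BettiUniverse.hodge hHD hX 2).hodgeNumber 2 0 ≤ C(p−1, 3)`  (`X = fermatHypersurface 2 p`)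

("every holomorphic `2`-form on the Fermat surface is a residue `Res(PΩ/F)`, `deg P = p − 4`"; Shioda 1979 (1.7)). This file records
`fermatGenus_of_le` (inequality ⇒ equality) and the compositions **K1-A ⟸ {F1‡, hFermatLe, CDK}** (+ the F1† road).

## References

* [Shioda1979HodgeFermat] T. Shioda, The Hodge conjecture for Fermat varieties, Math. Ann. 245 (1979), §1 (1.7).
* [CarlsonToledo1999] J. A. Carlson, D. Toledo, Duke Math. J. 97 (1999), §2, §5, §6, §7 Theorem 7.1.
* [CattaniDeligneKaplan1995] E. Cattani, P. Deligne, A. Kaplan, J. Amer. Math. Soc. 8 (1995), Thm. 1.1, Cor. 1.2.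
-/

noncomputable section


set_option linter.dupNamespace false

namespace Summit.HodgeConjecture.HodgeConjecture.Theorems.CyclicUnitaryPowersK1OfFermatGenusLe

open MvPolynomial CategoryTheory
open Literature.AlgebraicGeometry.Motives Literature.AlgebraicGeometry.HodgeTheory
open Summit.HodgeConjecture.HodgeConjecture.Theorems.CyclicUnitaryPowersK1OfFermatGenus

/-- **Inequality ⇒ equality for the Fermat genus**: `h^{2,0}(X²_p) ≤ C(p−1,3)` for the Fermat surfaces of prime degree `p ≥ 5`
gives `h^{2,0}(X²_p) = C(p−1,3)`, the lower bound being the tree's `choose_le_geometricGenus` (residues at pole order one).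
[cite: Shioda1979HodgeFermat, §1 (1.7)] -/
theorem fermatGenus_of_le
    (hFermatLe : ∀ ⦃p : ℕ⦄, p.Prime → 5 ≤ p → ∀ (hHD : exists_isReal_hodgeModel)
      (hX : IsSmoothProjective 2 (fermatHypersurface 2 p)), (BettiUniverse.hodge hHD hX 2).hodgeNumber 2 0 ≤ Nat.choose (p - 1) 3) :
    ∀ ⦃p : ℕ⦄, p.Prime → 5 ≤ p → ∀ (hHD : exists_isReal_hodgeModel)
      (hX : IsSmoothProjective 2 (fermatHypersurface 2 p)), (BettiUniverse.hodge hHD hX 2).hodgeNumber 2 0 = Nat.choose (p - 1) 3 := by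
  intro p hp hp5 hHD hX
  haveI : NeZero p := ⟨hp.ne_zero⟩
  refine le_antisymm (hFermatLe hp hp5 hHD hX) ?_
  exact choose_le_geometricGenus hHD (n := 2) (by norm_num) (isHomogeneous_fermatPolynomial 2 p)
    (SmoothHypersurface.isNonsingularForm_sum_X_pow (Nat.cast_ne_zero.mpr (NeZero.ne p))) hX

/-- **K1 `VeryGeneralDeckCommutatorsInHg` from {F1‡, `h^{2,0}(X²_p) ≤ C(p−1,3)`, CDK}** — the minimal residual form of PG.
CONDITIONAL; nothing here says HC ∕ HC_AV is proved. [cite: CarlsonToledo1999, §2, §5, §6 (kdoublept), §7 Theorem 7.1]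
[cite: CattaniDeligneKaplan1995, Thm. 1.1 and Cor. 1.2] [cite: Shioda1979HodgeFermat, §1 (1.7)] -/
theorem veryGeneralDeckCommutatorsInHg_of_localMonodromyBound_fermatGenusLe
    (hF1 : carlsonToledo1999_nodalMeridianLocalMonodromyBound)
    (hFermatLe : ∀ ⦃p : ℕ⦄, p.Prime → 5 ≤ p → ∀ (hHD : exists_isReal_hodgeModel)
      (hX : IsSmoothProjective 2 (fermatHypersurface 2 p)), (BettiUniverse.hodge hHD hX 2).hodgeNumber 2 0 ≤ Nat.choose (p - 1) 3)
    (hCDK : cmsp_nonHodgeGenericPoints_countable_algebraic_cover) :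
    Summit.HodgeConjecture.HodgeConjecture.Theses.CyclicUnitaryPowers.VeryGeneralDeckCommutatorsInHg :=
  veryGeneralDeckCommutatorsInHg_of_localMonodromyBound_fermatGenus hF1 (fermatGenus_of_le hFermatLe) @hCDK

/-- **The rung leaf `CyclicSurfacePowersHodge` from the same three inputs.** CONDITIONAL; rung F-H1 not moved.
[cite: CarlsonToledo1999, §2, §5, §6 (kdoublept), §7 Theorem 7.1] [cite: CattaniDeligneKaplan1995, Thm. 1.1 and Cor. 1.2] -/
theorem cyclicSurfacePowersHodge_of_localMonodromyBound_fermatGenusLe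
    (hF1 : carlsonToledo1999_nodalMeridianLocalMonodromyBound)
    (hFermatLe : ∀ ⦃p : ℕ⦄, p.Prime → 5 ≤ p → ∀ (hHD : exists_isReal_hodgeModel)
      (hX : IsSmoothProjective 2 (fermatHypersurface 2 p)), (BettiUniverse.hodge hHD hX 2).hodgeNumber 2 0 ≤ Nat.choose (p - 1) 3)
    (hCDK : cmsp_nonHodgeGenericPoints_countable_algebraic_cover) :
    Summit.HodgeConjecture.HodgeConjecture.Theses.CyclicUnitaryPowers.CyclicSurfacePowersHodge :=
  cyclicSurfacePowersHodge_of_localMonodromyBound_fermatGenus hF1 (fermatGenus_of_le hFermatLe) @hCDK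

/-- **The F1† road** with the inequality form. CONDITIONAL. [cite: CarlsonToledo1999, §2, §5, §6, §7 Thm. 7.1]
[cite: CattaniDeligneKaplan1995, Thm. 1.1 and Cor. 1.2] -/
theorem veryGeneralDeckCommutatorsInHg_of_localMonodromy_fermatGenusLe
    (hF1 : carlsonToledo1999_nodalMeridianLocalMonodromy)
    (hFermatLe : ∀ ⦃p : ℕ⦄, p.Prime → 5 ≤ p → ∀ (hHD : exists_isReal_hodgeModel)
      (hX : IsSmoothProjective 2 (fermatHypersurface 2 p)), (BettiUniverse.hodge hHD hX 2).hodgeNumber 2 0 ≤ Nat.choose (p - 1) 3)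
    (hCDK : cmsp_nonHodgeGenericPoints_countable_algebraic_cover) :
    Summit.HodgeConjecture.HodgeConjecture.Theses.CyclicUnitaryPowers.VeryGeneralDeckCommutatorsInHg :=
  veryGeneralDeckCommutatorsInHg_of_localMonodromy_fermatGenus hF1 (fermatGenus_of_le hFermatLe) @hCDK

end Summit.HodgeConjecture.HodgeConjecture.Theorems.CyclicUnitaryPowersK1OfFermatGenusLe

end
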